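import Literature.NumberTheory.Automorphic.ArchTorusOrbitalDeriv             -- ★ (V2)-smooth (p839771, this seat): `hasDerivAt_integral_comp_conj_archDiagTorus_curve`, `contDiffOn_one_…`
import Literature.NumberTheory.Automorphic.ArchTorusOrbitalFunctionAtPoint    -- ★ junction (p839451, F0P3a-p02): (j2) `archStableOrbitalIntegral_archDiagTorus_eq_inv_mul_sum_integral_conj`
import Literature.NumberTheory.Automorphic.UnitaryGroupArchTestLift           -- ★ `exists_smooth_lift_of_isArchTest` (the letter currency `T.IsArchTest` ↦ ambient-smooth `Θ`)
import HarnessLib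

/-!
# The STABLE archimedean torus orbital integral `ψ ↦ Φ^st_∞(t(z_ψ), f_∞)` is `C¹` along the one-angle torus curves on the regular set, with the derivative under the integral sign
# (ROAD-Sd (V2)-smooth-st: the stable junction of ★ (V2)-smooth; Rogawski 1990 §8.2 Prop. 8.2.1 p. 118, §8.3 p. 123)

Topic `NumberTheory/Automorphic`; namespace `Literature.NumberTheory.Automorphic.UnitaryGroup`.  THEOREMS ONLY (no `def`, no instance, no notation, no axiom, no `sorry`).
Cell `pub/hodgecm-mathlib`, ENGINE T1 (crux H413 = `stmt-HodgeConjecture-24833`); floor-1 preparation, count-neutral, under books rows #111 (S-d) ∕ #88 (ST-∞); author F0P3a-p07 (g6).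

SETTING.  `L` CM, `G′_∞ = U(diag α)(L⁺ ⊗ ℝ) ≤ GL_N(L ⊗ ℝ)` (★ `arch`; `α_i ≠ 0`, `c α_i = α_i`), `t(z)` the diagonal torus in circle coordinates (★ `archDiagTorus`), `ν` a Haar measure
on `G′_∞`, `m` an orbital-measure family canonical on the regular classes for `ν` (★ (V8)-orb).  The one-angle torus curve `z_ψ = (z₀_{w,i} · e^{i c_{w,i} ψ})`, its PERMUTED
companions `z_ψ ∘ ρ` (`ρ ∈ Π_w S_N`; again one-angle curves, with data `(z₀_w ∘ ρ_w, c_w ∘ ρ_w)`), the tangents `T′_ρ(ψ) = diag((0, (z₀_{w,ρ_w i} e^{i c ψ} · i c_{w,ρ_w i})_w)_i)`.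
TEST FUNCTIONS: the ambient-smooth currency `Θ : M_N(L ⊗ ℝ) → ℂ`, `ContDiff ℝ 1 Θ`, compact support ON THE GROUP (§2), and the letter currency `T.IsArchTest` (§3, ★
`exists_smooth_lift_of_isArchTest`).

* §1 `curve_comp_perm` (the permuted curve `z_ψ ∘ ρ` IS the one-angle curve with data `(z₀_w ∘ ρ_w, c_w ∘ ρ_w)`, `rfl`, stated for rewriting by name), `injective_curve_comp_perm`
  (regularity is permutation-invariant), `isOpen_setOf_forall_injective_curve` (the regular `ψ`-set is open); the (j2)-summands along the curve:
  `hasDerivAt_integral_comp_conj_archDiagTorus_curve_comp_perm`, `contDiffOn_one_integral_comp_conj_archDiagTorus_curve_comp_perm` (★ (V2)-smooth at the permuted data, any `E`).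
* §2 **`hasDerivAt_archStableOrbitalIntegral_archDiagTorus_curve`** — at every regular `ψ₀`:
  `d/dψ|_{ψ₀} Φ^st_∞(t(z_ψ), Θ∘↑↑·) = K⁻¹ · Σ_ρ ∫_{G′_∞} DΘ(↑↑(g·t(z_{ψ₀}∘ρ)·g⁻¹))[↑↑g · T′_ρ(ψ₀) · ↑↑g⁻¹] dν(g)`, `K = Π_w p_w!(N−p_w)!` ((j2) is an `EqOn` on the OPEN regular
  `ψ`-set ⇒ `HasDerivAt.congr_of_eventuallyEq`; termwise `hasDerivAt_integral_comp_conj_archDiagTorus_curve_comp_perm` = ★ `hasDerivAt_integral_comp_conj_archDiagTorus_curve` at the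
  permuted data); `deriv_archStableOrbitalIntegral_archDiagTorus_curve`;
  **`contDiffOn_one_archStableOrbitalIntegral_archDiagTorus_curve`** — `ψ ↦ Φ^st_∞(t(z_ψ), Θ∘↑↑·)` is `C¹` on `{ψ | z_ψ regular}`.
* §3 THE LETTER CURRENCY: **`contDiffOn_one_integral_comp_conj_archDiagTorus_curve_of_isArchTest`** and **`contDiffOn_one_archStableOrbitalIntegral_archDiagTorus_curve_of_isArchTest`** —
  for a pure tensor `T` with `T.IsArchTest`, both the torus orbital function `ψ ↦ ∫ f_∞(g·t(z_ψ)·g⁻¹) dν` and `ψ ↦ Φ^st_∞(t(z_ψ), f_∞)` (`f_∞ = T.arch`) are `C¹` on the regular `ψ`-set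
  (★ `exists_smooth_lift_of_isArchTest`: `f_∞ = Θ∘↑↑·` with `Θ` `C^∞`; compact support on the group is ★ `IsArchTest.hasCompactSupport_arch`).
NOT HERE: `C^∞`; the singular set and the jump letters ((L-jump)); closed forms of the derivative at `ψ = 0`.  HONEST LABEL: real analysis and finite book-keeping; HC_CM is proved only
modulo the printed citations until rung 0 closes, and this file pays nothing by itself.

## References
* [Rogawski1990] J. D. Rogawski, *Automorphic Representations of Unitary Groups in Three Variables*, Ann. of Math. Stud. 123 (1990), §4.1 (4.1.1) p. 39, §8.2 Prop. 8.2.1 p. 118,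
  §8.3 p. 123 (smoothness of `Φ^st(γ, f)` on the regular set of the compact Cartan; the limit formulas).
* [Shelstad1979] D. Shelstad, *Characters and inner forms of a quasi-split group over ℝ*, Compositio Math. 39 (1979), §4 (`F_f` smooth on `T_reg`).
* [Folland1995] G. B. Folland, *A Course in Abstract Harmonic Analysis* (1995), §2.6 (differentiation under the integral sign).
-/

set_option autoImplicit false

noncomputable section

open MeasureTheory Measure NumberField NumberField.InfinitePlace NumberField.mixedEmbedding Filter Topology Set Equiv
open Literature.NumberTheory.Rogawski1990 Literature.LinearAlgebra.Matrix
open scoped Matrix MatrixGroups Real Classical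

namespace Literature.NumberTheory.Automorphic.UnitaryGroup

-- the scoped operator norm on `M_N(L ⊗ ℝ)`, as in ★ `ArchimedeanCalculus` ∕ ★ `ArchTorusOrbitalDeriv`
open scoped Matrix.Norms.Operator

variable (L : Type) [Field L] [NumberField L] [IsCMField L] (N : ℕ) (α : Fin N → L)

/-! ## §1 Book-keeping: the permuted curve is a one-angle curve; regularity is permutation-invariant -/

omit [NumberField L] [IsCMField L] in
/-- The permuted one-angle curve `z_ψ ∘ ρ` is the one-angle curve with data `(z₀_w ∘ ρ_w, c_w ∘ ρ_w)` (definitional; stated for rewriting by name).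
[cite: Rogawski1990, §8.2 Prop. 8.2.1 p. 118] -/
theorem curve_comp_perm (z₀ : {w : InfinitePlace L // IsComplex w} → Fin N → Circle) (c : {w : InfinitePlace L // IsComplex w} → Fin N → ℝ)
    (ρ : {w : InfinitePlace L // IsComplex w} → Perm (Fin N)) (ψ : ℝ) :
    (fun w => (fun i => z₀ w i * Circle.exp (c w i * ψ)) ∘ ρ w) = fun w i => z₀ w (ρ w i) * Circle.exp (c w (ρ w i) * ψ) := rfl

omit [NumberField L] [IsCMField L] in
/-- Regularity (`∀ w, z_w injective`) passes to the permuted point `z ∘ ρ`. [cite: Rogawski1990, §8.2 Prop. 8.2.1 p. 118] -/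
theorem injective_curve_comp_perm (z₀ : {w : InfinitePlace L // IsComplex w} → Fin N → Circle) (c : {w : InfinitePlace L // IsComplex w} → Fin N → ℝ)
    (ρ : {w : InfinitePlace L // IsComplex w} → Perm (Fin N)) {ψ : ℝ} (hz : ∀ w, Function.Injective (fun i => z₀ w i * Circle.exp (c w i * ψ))) (w : {w : InfinitePlace L // IsComplex w}) :
    Function.Injective (fun i => z₀ w (ρ w i) * Circle.exp (c w (ρ w i) * ψ)) :=
  (hz w).comp (ρ w).injective

omit [IsCMField L] in
/-- The regular `ψ`-set `{ψ | ∀ w, z_ψ w injective}` of a one-angle curve is OPEN (★ `Literature.Topology.isOpen_setOf_forall_injective`, ★ `continuous_torusCurve`).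
[cite: Shelstad1979, §4] -/
theorem isOpen_setOf_forall_injective_curve (z₀ : {w : InfinitePlace L // IsComplex w} → Fin N → Circle) (c : {w : InfinitePlace L // IsComplex w} → Fin N → ℝ) :
    IsOpen {ψ : ℝ | ∀ w, Function.Injective (fun i => z₀ w i * Circle.exp (c w i * ψ))} :=
  (Literature.Topology.isOpen_setOf_forall_injective).preimage (continuous_pi fun w => continuous_torusCurve (z₀ w) (c w))

/-! ## §2 The stable torus orbital integral along the curve: derivative under the integral sign, `C¹` on the regular set -/

variable [MeasurableSpace (arch (↥(maximalRealSubfield L)) L (IsCMField.complexConj L) N (Matrix.diagonal α))] [BorelSpace (arch (↥(maximalRealSubfield L)) L (IsCMField.complexConj L) N (Matrix.diagonal α))]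
  [∀ g : ↥(arch (↥(maximalRealSubfield L)) L (IsCMField.complexConj L) N (Matrix.diagonal α)),
    MeasurableSpace (↥(arch (↥(maximalRealSubfield L)) L (IsCMField.complexConj L) N (Matrix.diagonal α)) ⧸
      Subgroup.centralizer ({g} : Set ↥(arch (↥(maximalRealSubfield L)) L (IsCMField.complexConj L) N (Matrix.diagonal α))))]
  [∀ g : ↥(arch (↥(maximalRealSubfield L)) L (IsCMField.complexConj L) N (Matrix.diagonal α)),
    BorelSpace (↥(arch (↥(maximalRealSubfield L)) L (IsCMField.complexConj L) N (Matrix.diagonal α)) ⧸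
      Subgroup.centralizer ({g} : Set ↥(arch (↥(maximalRealSubfield L)) L (IsCMField.complexConj L) N (Matrix.diagonal α))))]

omit [∀ g : ↥(arch (↥(maximalRealSubfield L)) L (IsCMField.complexConj L) N (Matrix.diagonal α)),
    MeasurableSpace (↥(arch (↥(maximalRealSubfield L)) L (IsCMField.complexConj L) N (Matrix.diagonal α)) ⧸
      Subgroup.centralizer ({g} : Set ↥(arch (↥(maximalRealSubfield L)) L (IsCMField.complexConj L) N (Matrix.diagonal α))))]
  [∀ g : ↥(arch (↥(maximalRealSubfield L)) L (IsCMField.complexConj L) N (Matrix.diagonal α)),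
    BorelSpace (↥(arch (↥(maximalRealSubfield L)) L (IsCMField.complexConj L) N (Matrix.diagonal α)) ⧸
      Subgroup.centralizer ({g} : Set ↥(arch (↥(maximalRealSubfield L)) L (IsCMField.complexConj L) N (Matrix.diagonal α))))] in
/-- **The (j2)-summand at `ρ` along the curve, differentiated under the integral sign**: the torus orbital function at the PERMUTED curve `z_ψ ∘ ρ` (in the `∘` spelling
that (j2) ★ `archStableOrbitalIntegral_archDiagTorus_eq_inv_mul_sum_integral_conj` prints) has, at a regular `ψ₀`, the derivative of ★ `hasDerivAt_integral_comp_conj_archDiagTorus_curve`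
for the permuted data `(z₀_w ∘ ρ_w, c_w ∘ ρ_w)`. [cite: Rogawski1990, §8.2 Prop. 8.2.1 p. 118; §8.3 p. 123] [cite: Folland1995, §2.6] -/
theorem hasDerivAt_integral_comp_conj_archDiagTorus_curve_comp_perm (hα : ∀ i, α i ≠ 0)
    (ν : Measure (arch (↥(maximalRealSubfield L)) L (IsCMField.complexConj L) N (Matrix.diagonal α))) [IsFiniteMeasureOnCompacts ν]
    {E : Type*} [NormedAddCommGroup E] [NormedSpace ℝ E] (Θ : Matrix (Fin N) (Fin N) (mixedSpace L) → E) (hΘ : ContDiff ℝ 1 Θ)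
    (hfc : HasCompactSupport fun k : arch (↥(maximalRealSubfield L)) L (IsCMField.complexConj L) N (Matrix.diagonal α) =>
      Θ (((k : GL (Fin N) (mixedSpace L)) : Matrix (Fin N) (Fin N) (mixedSpace L))))
    (z₀ : {w : InfinitePlace L // IsComplex w} → Fin N → Circle) (c : {w : InfinitePlace L // IsComplex w} → Fin N → ℝ)
    (ρ : {w : InfinitePlace L // IsComplex w} → Perm (Fin N)) (ψ₀ : ℝ) (hz : ∀ w, Function.Injective (fun i => z₀ w i * Circle.exp (c w i * ψ₀))) :
    HasDerivAt (fun ψ : ℝ => ∫ g : arch (↥(maximalRealSubfield L)) L (IsCMField.complexConj L) N (Matrix.diagonal α),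
        Θ (((g * archDiagTorus L N α (fun w => (fun i => z₀ w i * Circle.exp (c w i * ψ)) ∘ ρ w) * g⁻¹ : arch (↥(maximalRealSubfield L)) L (IsCMField.complexConj L) N (Matrix.diagonal α)) : GL (Fin N) (mixedSpace L)) : Matrix (Fin N) (Fin N) (mixedSpace L)) ∂ν)
      (∫ g : arch (↥(maximalRealSubfield L)) L (IsCMField.complexConj L) N (Matrix.diagonal α),
          fderiv ℝ Θ (((g * archDiagTorus L N α (fun w i => z₀ w (ρ w i) * Circle.exp (c w (ρ w i) * ψ₀)) * g⁻¹ : arch (↥(maximalRealSubfield L)) L (IsCMField.complexConj L) N (Matrix.diagonal α)) : GL (Fin N) (mixedSpace L)) : Matrix (Fin N) (Fin N) (mixedSpace L))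
            (((g : GL (Fin N) (mixedSpace L)) : Matrix (Fin N) (Fin N) (mixedSpace L)) * (Matrix.diagonal fun i => ((0 : {w : InfinitePlace L // IsReal w} → ℝ),
              fun w => (z₀ w (ρ w i) : ℂ) * (Complex.exp ((c w (ρ w i) * ψ₀ : ℝ) * Complex.I) * ((c w (ρ w i) : ℂ) * Complex.I)))) *
              (((g⁻¹ : arch (↥(maximalRealSubfield L)) L (IsCMField.complexConj L) N (Matrix.diagonal α)) : GL (Fin N) (mixedSpace L)) : Matrix (Fin N) (Fin N) (mixedSpace L))) ∂ν) ψ₀ := by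
  have h := (hasDerivAt_integral_comp_conj_archDiagTorus_curve L N α hα ν Θ hΘ hfc (fun w i => z₀ w (ρ w i)) (fun w i => c w (ρ w i)) ψ₀
    (injective_curve_comp_perm L N z₀ c ρ hz)).2
  simp only [Function.comp_def]
  exact h

/-- **THE STABLE ARCHIMEDEAN TORUS ORBITAL INTEGRAL IS DIFFERENTIABLE ALONG THE ONE-ANGLE CURVES ON THE REGULAR SET, WITH THE DERIVATIVE UNDER THE INTEGRAL SIGN**:
for `Θ` `C¹` on `M_N(L ⊗ ℝ)` with compact support on `G′_∞`, `m` canonical on the regular classes for the Haar measure `ν`, and `z_{ψ₀}` regular,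
`d/dψ|_{ψ₀} Φ^st_∞(t(z_ψ), Θ∘↑↑·) = K⁻¹ · Σ_{ρ ∈ Π_w S_N} ∫ DΘ(↑↑(g·t(z_{ψ₀}∘ρ)·g⁻¹))[↑↑g · T′_ρ(ψ₀) · ↑↑g⁻¹] dν(g)` ((j2) ★ `archStableOrbitalIntegral_archDiagTorus_eq_inv_mul_sum_integral_conj`
on the open regular `ψ`-set, termwise ★ `hasDerivAt_integral_comp_conj_archDiagTorus_curve` at the permuted curve data). [cite: Rogawski1990, §8.2 Prop. 8.2.1 p. 118; §8.3 p. 123]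
[cite: Shelstad1979, §4] [cite: Folland1995, §2.6] -/
theorem hasDerivAt_archStableOrbitalIntegral_archDiagTorus_curve (hα : ∀ i, α i ≠ 0)
    (hherm : ∀ i, (IsCMField.complexConj L (α i) : L) = α i)
    {ν : Measure (arch (↥(maximalRealSubfield L)) L (IsCMField.complexConj L) N (Matrix.diagonal α))} [ν.IsHaarMeasure] [ν.IsMulRightInvariant]
    {m : OrbitalMeasureFamily ↥(arch (↥(maximalRealSubfield L)) L (IsCMField.complexConj L) N (Matrix.diagonal α))}
    (hm : m.IsCanonical (fun γ => IsRegularElt (γ.val : GL (Fin N) (mixedSpace L))) ν)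
    (Θ : Matrix (Fin N) (Fin N) (mixedSpace L) → ℂ) (hΘ : ContDiff ℝ 1 Θ)
    (hfc : HasCompactSupport fun k : arch (↥(maximalRealSubfield L)) L (IsCMField.complexConj L) N (Matrix.diagonal α) =>
      Θ (((k : GL (Fin N) (mixedSpace L)) : Matrix (Fin N) (Fin N) (mixedSpace L))))
    (z₀ : {w : InfinitePlace L // IsComplex w} → Fin N → Circle) (c : {w : InfinitePlace L // IsComplex w} → Fin N → ℝ)
    (ψ₀ : ℝ) (hz : ∀ w, Function.Injective (fun i => z₀ w i * Circle.exp (c w i * ψ₀))) :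
    HasDerivAt (fun ψ : ℝ => archStableOrbitalIntegral L N (Matrix.diagonal α) m (fun k : arch (↥(maximalRealSubfield L)) L (IsCMField.complexConj L) N (Matrix.diagonal α) => Θ (((k : GL (Fin N) (mixedSpace L)) : Matrix (Fin N) (Fin N) (mixedSpace L))))
        (archDiagTorus L N α (fun w i => z₀ w i * Circle.exp (c w i * ψ))))
      (((∏ w : {w : InfinitePlace L // IsComplex w},
          (Finset.univ.filter fun i => 0 < (w.1.embedding (α i)).re).card.factorial *
            (N - (Finset.univ.filter fun i => 0 < (w.1.embedding (α i)).re).card).factorial : ℕ) : ℂ)⁻¹ *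
        ∑ ρ : {w : InfinitePlace L // IsComplex w} → Perm (Fin N), ∫ g : arch (↥(maximalRealSubfield L)) L (IsCMField.complexConj L) N (Matrix.diagonal α),
          fderiv ℝ Θ (((g * archDiagTorus L N α (fun w i => z₀ w (ρ w i) * Circle.exp (c w (ρ w i) * ψ₀)) * g⁻¹ : arch (↥(maximalRealSubfield L)) L (IsCMField.complexConj L) N (Matrix.diagonal α)) : GL (Fin N) (mixedSpace L)) : Matrix (Fin N) (Fin N) (mixedSpace L))
            (((g : GL (Fin N) (mixedSpace L)) : Matrix (Fin N) (Fin N) (mixedSpace L)) * (Matrix.diagonal fun i => ((0 : {w : InfinitePlace L // IsReal w} → ℝ),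
              fun w => (z₀ w (ρ w i) : ℂ) * (Complex.exp ((c w (ρ w i) * ψ₀ : ℝ) * Complex.I) * ((c w (ρ w i) : ℂ) * Complex.I)))) *
              (((g⁻¹ : arch (↥(maximalRealSubfield L)) L (IsCMField.complexConj L) N (Matrix.diagonal α)) : GL (Fin N) (mixedSpace L)) : Matrix (Fin N) (Fin N) (mixedSpace L))) ∂ν) ψ₀ := by
  have hfcont : Continuous (fun k : arch (↥(maximalRealSubfield L)) L (IsCMField.complexConj L) N (Matrix.diagonal α) => Θ (((k : GL (Fin N) (mixedSpace L)) : Matrix (Fin N) (Fin N) (mixedSpace L)))) :=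
    hΘ.continuous.comp (Units.continuous_val.comp continuous_subtype_val)
  -- (j2) on the open regular set, as an eventual equality at `ψ₀`
  have hev : (fun ψ : ℝ => archStableOrbitalIntegral L N (Matrix.diagonal α) m (fun k : arch (↥(maximalRealSubfield L)) L (IsCMField.complexConj L) N (Matrix.diagonal α) => Θ (((k : GL (Fin N) (mixedSpace L)) : Matrix (Fin N) (Fin N) (mixedSpace L))))
        (archDiagTorus L N α (fun w i => z₀ w i * Circle.exp (c w i * ψ)))) =ᶠ[𝓝 ψ₀]
      fun ψ => ((∏ w : {w : InfinitePlace L // IsComplex w},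
          (Finset.univ.filter fun i => 0 < (w.1.embedding (α i)).re).card.factorial *
            (N - (Finset.univ.filter fun i => 0 < (w.1.embedding (α i)).re).card).factorial : ℕ) : ℂ)⁻¹ *
        ∑ ρ : {w : InfinitePlace L // IsComplex w} → Perm (Fin N), ∫ g : arch (↥(maximalRealSubfield L)) L (IsCMField.complexConj L) N (Matrix.diagonal α),
          Θ (((g * archDiagTorus L N α (fun w => (fun i => z₀ w i * Circle.exp (c w i * ψ)) ∘ ρ w) * g⁻¹ : arch (↥(maximalRealSubfield L)) L (IsCMField.complexConj L) N (Matrix.diagonal α)) : GL (Fin N) (mixedSpace L)) : Matrix (Fin N) (Fin N) (mixedSpace L)) ∂ν := by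
    filter_upwards [(isOpen_setOf_forall_injective_curve L N z₀ c).mem_nhds hz] with ψ hψ
    exact archStableOrbitalIntegral_archDiagTorus_eq_inv_mul_sum_integral_conj L N α hα hherm hm hψ _ hfcont
  refine HasDerivAt.congr_of_eventuallyEq ?_ hev
  refine HasDerivAt.const_mul _ ?_
  exact HasDerivAt.fun_sum fun ρ _ => hasDerivAt_integral_comp_conj_archDiagTorus_curve_comp_perm L N α hα ν Θ hΘ hfc z₀ c ρ ψ₀ hz

/-- **The `deriv` form** of `hasDerivAt_archStableOrbitalIntegral_archDiagTorus_curve`. [cite: Rogawski1990, §8.2 Prop. 8.2.1 p. 118; §8.3 p. 123] -/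
theorem deriv_archStableOrbitalIntegral_archDiagTorus_curve (hα : ∀ i, α i ≠ 0)
    (hherm : ∀ i, (IsCMField.complexConj L (α i) : L) = α i)
    {ν : Measure (arch (↥(maximalRealSubfield L)) L (IsCMField.complexConj L) N (Matrix.diagonal α))} [ν.IsHaarMeasure] [ν.IsMulRightInvariant]
    {m : OrbitalMeasureFamily ↥(arch (↥(maximalRealSubfield L)) L (IsCMField.complexConj L) N (Matrix.diagonal α))}
    (hm : m.IsCanonical (fun γ => IsRegularElt (γ.val : GL (Fin N) (mixedSpace L))) ν)
    (Θ : Matrix (Fin N) (Fin N) (mixedSpace L) → ℂ) (hΘ : ContDiff ℝ 1 Θ)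
    (hfc : HasCompactSupport fun k : arch (↥(maximalRealSubfield L)) L (IsCMField.complexConj L) N (Matrix.diagonal α) =>
      Θ (((k : GL (Fin N) (mixedSpace L)) : Matrix (Fin N) (Fin N) (mixedSpace L))))
    (z₀ : {w : InfinitePlace L // IsComplex w} → Fin N → Circle) (c : {w : InfinitePlace L // IsComplex w} → Fin N → ℝ)
    (ψ₀ : ℝ) (hz : ∀ w, Function.Injective (fun i => z₀ w i * Circle.exp (c w i * ψ₀))) :
    deriv (fun ψ : ℝ => archStableOrbitalIntegral L N (Matrix.diagonal α) m (fun k : arch (↥(maximalRealSubfield L)) L (IsCMField.complexConj L) N (Matrix.diagonal α) => Θ (((k : GL (Fin N) (mixedSpace L)) : Matrix (Fin N) (Fin N) (mixedSpace L))))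
        (archDiagTorus L N α (fun w i => z₀ w i * Circle.exp (c w i * ψ)))) ψ₀ =
      ((∏ w : {w : InfinitePlace L // IsComplex w},
          (Finset.univ.filter fun i => 0 < (w.1.embedding (α i)).re).card.factorial *
            (N - (Finset.univ.filter fun i => 0 < (w.1.embedding (α i)).re).card).factorial : ℕ) : ℂ)⁻¹ *
        ∑ ρ : {w : InfinitePlace L // IsComplex w} → Perm (Fin N), ∫ g : arch (↥(maximalRealSubfield L)) L (IsCMField.complexConj L) N (Matrix.diagonal α),
          fderiv ℝ Θ (((g * archDiagTorus L N α (fun w i => z₀ w (ρ w i) * Circle.exp (c w (ρ w i) * ψ₀)) * g⁻¹ : arch (↥(maximalRealSubfield L)) L (IsCMField.complexConj L) N (Matrix.diagonal α)) : GL (Fin N) (mixedSpace L)) : Matrix (Fin N) (Fin N) (mixedSpace L))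
            (((g : GL (Fin N) (mixedSpace L)) : Matrix (Fin N) (Fin N) (mixedSpace L)) * (Matrix.diagonal fun i => ((0 : {w : InfinitePlace L // IsReal w} → ℝ),
              fun w => (z₀ w (ρ w i) : ℂ) * (Complex.exp ((c w (ρ w i) * ψ₀ : ℝ) * Complex.I) * ((c w (ρ w i) : ℂ) * Complex.I)))) *
              (((g⁻¹ : arch (↥(maximalRealSubfield L)) L (IsCMField.complexConj L) N (Matrix.diagonal α)) : GL (Fin N) (mixedSpace L)) : Matrix (Fin N) (Fin N) (mixedSpace L))) ∂ν :=
  (hasDerivAt_archStableOrbitalIntegral_archDiagTorus_curve L N α hα hherm hm Θ hΘ hfc z₀ c ψ₀ hz).deriv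

omit [∀ g : ↥(arch (↥(maximalRealSubfield L)) L (IsCMField.complexConj L) N (Matrix.diagonal α)),
    MeasurableSpace (↥(arch (↥(maximalRealSubfield L)) L (IsCMField.complexConj L) N (Matrix.diagonal α)) ⧸
      Subgroup.centralizer ({g} : Set ↥(arch (↥(maximalRealSubfield L)) L (IsCMField.complexConj L) N (Matrix.diagonal α))))]
  [∀ g : ↥(arch (↥(maximalRealSubfield L)) L (IsCMField.complexConj L) N (Matrix.diagonal α)),
    BorelSpace (↥(arch (↥(maximalRealSubfield L)) L (IsCMField.complexConj L) N (Matrix.diagonal α)) ⧸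
      Subgroup.centralizer ({g} : Set ↥(arch (↥(maximalRealSubfield L)) L (IsCMField.complexConj L) N (Matrix.diagonal α))))] in
/-- **The (j2)-summand at `ρ` is `C¹` on the regular `ψ`-set** (★ `contDiffOn_one_integral_comp_conj_archDiagTorus_curve` at the permuted data; the regular set of `z` lies in that of
`z ∘ ρ`). [cite: Rogawski1990, §8.2 Prop. 8.2.1 p. 118; §8.3 p. 123] [cite: Shelstad1979, §4] -/
theorem contDiffOn_one_integral_comp_conj_archDiagTorus_curve_comp_perm (hα : ∀ i, α i ≠ 0)
    (ν : Measure (arch (↥(maximalRealSubfield L)) L (IsCMField.complexConj L) N (Matrix.diagonal α))) [IsFiniteMeasureOnCompacts ν]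
    {E : Type*} [NormedAddCommGroup E] [NormedSpace ℝ E] (Θ : Matrix (Fin N) (Fin N) (mixedSpace L) → E) (hΘ : ContDiff ℝ 1 Θ)
    (hfc : HasCompactSupport fun k : arch (↥(maximalRealSubfield L)) L (IsCMField.complexConj L) N (Matrix.diagonal α) =>
      Θ (((k : GL (Fin N) (mixedSpace L)) : Matrix (Fin N) (Fin N) (mixedSpace L))))
    (z₀ : {w : InfinitePlace L // IsComplex w} → Fin N → Circle) (c : {w : InfinitePlace L // IsComplex w} → Fin N → ℝ)
    (ρ : {w : InfinitePlace L // IsComplex w} → Perm (Fin N)) :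
    ContDiffOn ℝ 1 (fun ψ : ℝ => ∫ g : arch (↥(maximalRealSubfield L)) L (IsCMField.complexConj L) N (Matrix.diagonal α),
          Θ (((g * archDiagTorus L N α (fun w => (fun i => z₀ w i * Circle.exp (c w i * ψ)) ∘ ρ w) * g⁻¹ : arch (↥(maximalRealSubfield L)) L (IsCMField.complexConj L) N (Matrix.diagonal α)) : GL (Fin N) (mixedSpace L)) : Matrix (Fin N) (Fin N) (mixedSpace L)) ∂ν)
      {ψ : ℝ | ∀ w, Function.Injective (fun i => z₀ w i * Circle.exp (c w i * ψ))} := by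
  simp only [Function.comp_def]
  refine (contDiffOn_one_integral_comp_conj_archDiagTorus_curve L N α hα ν Θ hΘ hfc (fun w i => z₀ w (ρ w i)) (fun w i => c w (ρ w i))).mono ?_
  intro ψ hψ w
  exact injective_curve_comp_perm L N z₀ c ρ hψ w

/-- **THE STABLE ARCHIMEDEAN TORUS ORBITAL INTEGRAL IS `C¹` ALONG THE ONE-ANGLE CURVES ON THE REGULAR SET** `{ψ | z_ψ regular}`: by (j2) it is, on that open set, the constant
multiple `K⁻¹` of a finite sum of torus orbital functions at permuted (still regular) curve data, each `C¹` there by ★ `contDiffOn_one_integral_comp_conj_archDiagTorus_curve`.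
[cite: Rogawski1990, §8.2 Prop. 8.2.1 p. 118; §8.3 p. 123] [cite: Shelstad1979, §4] -/
theorem contDiffOn_one_archStableOrbitalIntegral_archDiagTorus_curve (hα : ∀ i, α i ≠ 0)
    (hherm : ∀ i, (IsCMField.complexConj L (α i) : L) = α i)
    {ν : Measure (arch (↥(maximalRealSubfield L)) L (IsCMField.complexConj L) N (Matrix.diagonal α))} [ν.IsHaarMeasure] [ν.IsMulRightInvariant]
    {m : OrbitalMeasureFamily ↥(arch (↥(maximalRealSubfield L)) L (IsCMField.complexConj L) N (Matrix.diagonal α))}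
    (hm : m.IsCanonical (fun γ => IsRegularElt (γ.val : GL (Fin N) (mixedSpace L))) ν)
    (Θ : Matrix (Fin N) (Fin N) (mixedSpace L) → ℂ) (hΘ : ContDiff ℝ 1 Θ)
    (hfc : HasCompactSupport fun k : arch (↥(maximalRealSubfield L)) L (IsCMField.complexConj L) N (Matrix.diagonal α) =>
      Θ (((k : GL (Fin N) (mixedSpace L)) : Matrix (Fin N) (Fin N) (mixedSpace L))))
    (z₀ : {w : InfinitePlace L // IsComplex w} → Fin N → Circle) (c : {w : InfinitePlace L // IsComplex w} → Fin N → ℝ) :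
    ContDiffOn ℝ 1 (fun ψ : ℝ => archStableOrbitalIntegral L N (Matrix.diagonal α) m (fun k : arch (↥(maximalRealSubfield L)) L (IsCMField.complexConj L) N (Matrix.diagonal α) => Θ (((k : GL (Fin N) (mixedSpace L)) : Matrix (Fin N) (Fin N) (mixedSpace L))))
        (archDiagTorus L N α (fun w i => z₀ w i * Circle.exp (c w i * ψ))))
      {ψ : ℝ | ∀ w, Function.Injective (fun i => z₀ w i * Circle.exp (c w i * ψ))} := by
  have hfcont : Continuous (fun k : arch (↥(maximalRealSubfield L)) L (IsCMField.complexConj L) N (Matrix.diagonal α) => Θ (((k : GL (Fin N) (mixedSpace L)) : Matrix (Fin N) (Fin N) (mixedSpace L)))) :=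
    hΘ.continuous.comp (Units.continuous_val.comp continuous_subtype_val)
  have heq : Set.EqOn (fun ψ : ℝ => archStableOrbitalIntegral L N (Matrix.diagonal α) m (fun k : arch (↥(maximalRealSubfield L)) L (IsCMField.complexConj L) N (Matrix.diagonal α) => Θ (((k : GL (Fin N) (mixedSpace L)) : Matrix (Fin N) (Fin N) (mixedSpace L))))
        (archDiagTorus L N α (fun w i => z₀ w i * Circle.exp (c w i * ψ))))
      (fun ψ => ((∏ w : {w : InfinitePlace L // IsComplex w},
          (Finset.univ.filter fun i => 0 < (w.1.embedding (α i)).re).card.factorial *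
            (N - (Finset.univ.filter fun i => 0 < (w.1.embedding (α i)).re).card).factorial : ℕ) : ℂ)⁻¹ *
        ∑ ρ : {w : InfinitePlace L // IsComplex w} → Perm (Fin N), ∫ g : arch (↥(maximalRealSubfield L)) L (IsCMField.complexConj L) N (Matrix.diagonal α),
          Θ (((g * archDiagTorus L N α (fun w => (fun i => z₀ w i * Circle.exp (c w i * ψ)) ∘ ρ w) * g⁻¹ : arch (↥(maximalRealSubfield L)) L (IsCMField.complexConj L) N (Matrix.diagonal α)) : GL (Fin N) (mixedSpace L)) : Matrix (Fin N) (Fin N) (mixedSpace L)) ∂ν)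
      {ψ : ℝ | ∀ w, Function.Injective (fun i => z₀ w i * Circle.exp (c w i * ψ))} :=
    fun ψ hψ => archStableOrbitalIntegral_archDiagTorus_eq_inv_mul_sum_integral_conj L N α hα hherm hm hψ _ hfcont
  refine ContDiffOn.congr ?_ heq
  refine contDiffOn_const.mul ?_
  exact ContDiffOn.sum fun ρ _ => contDiffOn_one_integral_comp_conj_archDiagTorus_curve_comp_perm L N α hα ν Θ hΘ hfc z₀ c ρ

/-! ## §3 The letter currency `T.IsArchTest` -/

omit [∀ g : ↥(arch (↥(maximalRealSubfield L)) L (IsCMField.complexConj L) N (Matrix.diagonal α)),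
    MeasurableSpace (↥(arch (↥(maximalRealSubfield L)) L (IsCMField.complexConj L) N (Matrix.diagonal α)) ⧸
      Subgroup.centralizer ({g} : Set ↥(arch (↥(maximalRealSubfield L)) L (IsCMField.complexConj L) N (Matrix.diagonal α))))]
  [∀ g : ↥(arch (↥(maximalRealSubfield L)) L (IsCMField.complexConj L) N (Matrix.diagonal α)),
    BorelSpace (↥(arch (↥(maximalRealSubfield L)) L (IsCMField.complexConj L) N (Matrix.diagonal α)) ⧸
      Subgroup.centralizer ({g} : Set ↥(arch (↥(maximalRealSubfield L)) L (IsCMField.complexConj L) N (Matrix.diagonal α))))] in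
/-- **For an archimedean test factor `f_∞ = T.arch` (`T.IsArchTest`) the torus orbital function `ψ ↦ ∫ f_∞(g·t(z_ψ)·g⁻¹) dν` is `C¹` along the one-angle curve on the regular set**
(`ν` finite on compacta): ★ `exists_smooth_lift_of_isArchTest` writes `f_∞ = Θ∘↑↑·` with `Θ` `C^∞` on `M_N(L ⊗ ℝ)`, the support on the group is compact (★ `IsArchTest.hasCompactSupport_arch`),
and ★ `contDiffOn_one_integral_comp_conj_archDiagTorus_curve` applies. [cite: Rogawski1990, §8.2 Prop. 8.2.1 p. 118; §8.3 p. 123] [cite: Shelstad1979, §4] -/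
theorem contDiffOn_one_integral_comp_conj_archDiagTorus_curve_of_isArchTest (hα : ∀ i, α i ≠ 0)
    (ν : Measure (arch (↥(maximalRealSubfield L)) L (IsCMField.complexConj L) N (Matrix.diagonal α))) [IsFiniteMeasureOnCompacts ν]
    (T : PureTensor L N (Matrix.diagonal α)) (hT : T.IsArchTest)
    (z₀ : {w : InfinitePlace L // IsComplex w} → Fin N → Circle) (c : {w : InfinitePlace L // IsComplex w} → Fin N → ℝ) :
    ContDiffOn ℝ 1 (fun ψ : ℝ => ∫ g : arch (↥(maximalRealSubfield L)) L (IsCMField.complexConj L) N (Matrix.diagonal α),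
        T.arch (g * archDiagTorus L N α (fun w i => z₀ w i * Circle.exp (c w i * ψ)) * g⁻¹) ∂ν)
      {ψ : ℝ | ∀ w, Function.Injective (fun i => z₀ w i * Circle.exp (c w i * ψ))} := by
  obtain ⟨Θ, hΘ, -, -, hΘT⟩ := exists_smooth_lift_of_isArchTest T hT
  have e : T.arch = (fun k : arch (↥(maximalRealSubfield L)) L (IsCMField.complexConj L) N (Matrix.diagonal α) => Θ (((k : GL (Fin N) (mixedSpace L)) : Matrix (Fin N) (Fin N) (mixedSpace L)))) := funext hΘT
  have hfc : HasCompactSupport (fun k : arch (↥(maximalRealSubfield L)) L (IsCMField.complexConj L) N (Matrix.diagonal α) => Θ (((k : GL (Fin N) (mixedSpace L)) : Matrix (Fin N) (Fin N) (mixedSpace L)))) := e ▸ hT.hasCompactSupport_arch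
  rw [e]
  exact contDiffOn_one_integral_comp_conj_archDiagTorus_curve L N α hα ν Θ (hΘ.of_le (by exact_mod_cast le_top)) hfc z₀ c

/-- **FOR AN ARCHIMEDEAN TEST FACTOR `f_∞ = T.arch` (`T.IsArchTest`) THE STABLE TORUS ORBITAL INTEGRAL `ψ ↦ Φ^st_∞(t(z_ψ), f_∞)` IS `C¹` ALONG THE ONE-ANGLE CURVE ON THE REGULAR SET**
(`m` canonical on the regular classes for the Haar measure `ν`; `c α_i = α_i ≠ 0`) — the smoothness input of the limit formulas [Rogawski1990, Prop. 8.3.2] on `T_reg` in the tree's letter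
currency. [cite: Rogawski1990, §8.2 Prop. 8.2.1 p. 118; §8.3 p. 123] [cite: Shelstad1979, §4] -/
theorem contDiffOn_one_archStableOrbitalIntegral_archDiagTorus_curve_of_isArchTest (hα : ∀ i, α i ≠ 0)
    (hherm : ∀ i, (IsCMField.complexConj L (α i) : L) = α i)
    {ν : Measure (arch (↥(maximalRealSubfield L)) L (IsCMField.complexConj L) N (Matrix.diagonal α))} [ν.IsHaarMeasure] [ν.IsMulRightInvariant]
    {m : OrbitalMeasureFamily ↥(arch (↥(maximalRealSubfield L)) L (IsCMField.complexConj L) N (Matrix.diagonal α))}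
    (hm : m.IsCanonical (fun γ => IsRegularElt (γ.val : GL (Fin N) (mixedSpace L))) ν)
    (T : PureTensor L N (Matrix.diagonal α)) (hT : T.IsArchTest)
    (z₀ : {w : InfinitePlace L // IsComplex w} → Fin N → Circle) (c : {w : InfinitePlace L // IsComplex w} → Fin N → ℝ) :
    ContDiffOn ℝ 1 (fun ψ : ℝ => archStableOrbitalIntegral L N (Matrix.diagonal α) m T.arch
        (archDiagTorus L N α (fun w i => z₀ w i * Circle.exp (c w i * ψ))))
      {ψ : ℝ | ∀ w, Function.Injective (fun i => z₀ w i * Circle.exp (c w i * ψ))} := by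
  obtain ⟨Θ, hΘ, -, -, hΘT⟩ := exists_smooth_lift_of_isArchTest T hT
  have e : T.arch = (fun k : arch (↥(maximalRealSubfield L)) L (IsCMField.complexConj L) N (Matrix.diagonal α) => Θ (((k : GL (Fin N) (mixedSpace L)) : Matrix (Fin N) (Fin N) (mixedSpace L)))) := funext hΘT
  have hfc : HasCompactSupport (fun k : arch (↥(maximalRealSubfield L)) L (IsCMField.complexConj L) N (Matrix.diagonal α) => Θ (((k : GL (Fin N) (mixedSpace L)) : Matrix (Fin N) (Fin N) (mixedSpace L)))) := e ▸ hT.hasCompactSupport_arch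
  rw [e]
  exact contDiffOn_one_archStableOrbitalIntegral_archDiagTorus_curve L N α hα hherm hm Θ (hΘ.of_le (by exact_mod_cast le_top)) hfc z₀ c

/-- **Differentiability form for the letters**: for `T.IsArchTest` and regular `ψ₀`, `ψ ↦ Φ^st_∞(t(z_ψ), T.arch)` is differentiable at `ψ₀`.
[cite: Rogawski1990, §8.2 Prop. 8.2.1 p. 118; §8.3 p. 123] -/
theorem differentiableAt_archStableOrbitalIntegral_archDiagTorus_curve_of_isArchTest (hα : ∀ i, α i ≠ 0)
    (hherm : ∀ i, (IsCMField.complexConj L (α i) : L) = α i)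
    {ν : Measure (arch (↥(maximalRealSubfield L)) L (IsCMField.complexConj L) N (Matrix.diagonal α))} [ν.IsHaarMeasure] [ν.IsMulRightInvariant]
    {m : OrbitalMeasureFamily ↥(arch (↥(maximalRealSubfield L)) L (IsCMField.complexConj L) N (Matrix.diagonal α))}
    (hm : m.IsCanonical (fun γ => IsRegularElt (γ.val : GL (Fin N) (mixedSpace L))) ν)
    (T : PureTensor L N (Matrix.diagonal α)) (hT : T.IsArchTest)
    (z₀ : {w : InfinitePlace L // IsComplex w} → Fin N → Circle) (c : {w : InfinitePlace L // IsComplex w} → Fin N → ℝ)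
    (ψ₀ : ℝ) (hz : ∀ w, Function.Injective (fun i => z₀ w i * Circle.exp (c w i * ψ₀))) :
    DifferentiableAt ℝ (fun ψ : ℝ => archStableOrbitalIntegral L N (Matrix.diagonal α) m T.arch
        (archDiagTorus L N α (fun w i => z₀ w i * Circle.exp (c w i * ψ)))) ψ₀ :=
  ((contDiffOn_one_archStableOrbitalIntegral_archDiagTorus_curve_of_isArchTest L N α hα hherm hm T hT z₀ c).differentiableOn one_ne_zero).differentiableAt
    ((isOpen_setOf_forall_injective_curve L N z₀ c).mem_nhds hz)

end Literature.NumberTheory.Automorphic.UnitaryGroup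

end
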